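import Literature.Geometry.Lorentzian.KerrSchildCoord
import Literature.Geometry.Lorentzian.KerrSchildTimeTranslation
import Summits.FinalStateConjecture.FinalStateConjecture.Theorems.BartnikGapSettlingGapExhaustionCylindersBendInwardOf
import HarnessLib

/-!
# `KerrBandRegularity`: uniform tube radius and `C²` bounds around a Kerr radial band
(crux `GapExhaustion`, stmt-FinalStateConjecture-10808, line photon-shell-pseudoconvexity;
stub (E-6) `stub_kerrBandRegularity` of §1f ESCAPE)

§1f pushes short straight chart segments `z + s v` from the points `z` of a radial band
`r_lo ≤ r ≤ r_hi` (all Kerr-star times `x⁰`) of the Kerr–Schild chart. This file supplies the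
uniform control needed for that: a tube radius `ρ₀ > 0` and constants `L₁, L₂, L₃, B₀ ≥ 0` such
that at every point `z + w`, `‖w‖ ≤ ρ₀`, of the closed `ρ₀`-tube around the band

* the Kerr–Schild radius stays `> r_lo / 2` (so `g_{M,a}` and `r` are `C²` there,
  `Kerr.contDiffAt_bilin`, `Kerr.contDiffAt_radius`),
* `|r(z + w) − r(z)| ≤ L₃ ‖w‖` (mean value inequality along the segment, which stays in the tube),
* `‖g_{M,a}‖ ≤ B₀`, `‖D g_{M,a}‖ ≤ L₁`, `‖Dr‖ ≤ L₃`, `‖D²r‖ ≤ L₂`.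

Proof: everything is invariant under the time translations `x ↦ x + t ∂₀`
(`Kerr.radius_add_time_smul_basisVector`, `Kerr.bilin_add_time`, and
`OpensChart.fderiv_eq_of_forall_add_eq` for the derivatives), so it suffices to work over the
compact time slice `K = {z⁰ = 0, r_lo ≤ r ≤ r_hi}` (`kerrCylindersBendInward_isCompact_slice`).
The open set `{r > r_lo/2}` contains `K`, hence a closed thickening `cthickening ρ₀ K`
(`IsCompact.exists_cthickening_subset_open`); that thickening is compact (`IsCompact.cthickening`),
lies in `{r > 0}` where the four fields are continuous, whence the bounds
(`IsCompact.exists_bound_of_continuousOn`). Exact Kerr only; no sign or size condition on `M, a`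
is needed (all claims are regularity/compactness facts on `{r > 0}`).

References: R. P. Kerr, A. Schild (1965), §§2–3 [KerrSchild1965]; M. Visser, arXiv:0706.0622,
(32)–(35) [arXiv07060622].
-/

noncomputable section

-- instance search through the nested operator types `E4 →L[ℝ] E4 →L[ℝ] E4 →L[ℝ] ℝ`
set_option maxSynthPendingDepth 3

-- D-0017: single-problem summit, `Summit.<S>.<S>.…` by design (cf. lakefile `weak.linter.dupNamespace`).
set_option linter.dupNamespace false

namespace Summit.FinalStateConjecture.FinalStateConjecture.Theorems

open Set Literature.Geometry.Lorentzian
open scoped Manifold ContDiff Topology ENNReal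

/-- **(E-6) Uniform regularity of exact Kerr on a tube around a radial band (crux `GapExhaustion`,
stmt-FinalStateConjecture-10808; line photon-shell-pseudoconvexity, §1f ESCAPE).** For
`0 < r_lo ≤ r_hi` there are `ρ₀ > 0` and `L₁, L₂, L₃, B₀ ≥ 0` such that for every point `z` of
Kerr–Schild coordinate space with `r_lo ≤ r(z) ≤ r_hi` (all times) and every `w` with `‖w‖ ≤ ρ₀`:
`r(z + w) > r_lo/2`, `|r(z + w) − r(z)| ≤ L₃‖w‖`, `g_{M,a}` and `r` are `C²` at `z + w`,
`‖g_{M,a}(z + w)‖ ≤ B₀`, `‖Dg_{M,a}(z + w)‖ ≤ L₁`, `‖Dr(z + w)‖ ≤ L₃`, `‖D²r(z + w)‖ ≤ L₂`.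
Compactness of the closed thickening of the time slice of the band inside `{r > r_lo/2}`,
continuity of the fields on `{r > 0}` (Kerr–Schild 1965, §3; Visser arXiv:0706.0622, (32)–(35)),
stationarity of Kerr, and the mean value inequality. -/
theorem stub_kerrBandRegularity :
    ∀ (M a r_lo r_hi : ℝ), 0 < r_lo → r_lo ≤ r_hi →
      ∃ (ρ₀ L₁ L₂ L₃ B₀ : ℝ), 0 < ρ₀ ∧ 0 ≤ L₁ ∧ 0 ≤ L₂ ∧ 0 ≤ L₃ ∧ 0 ≤ B₀ ∧
      ∀ z : E4, r_lo ≤ Kerr.radius a z → Kerr.radius a z ≤ r_hi → ∀ w : E4, ‖w‖ ≤ ρ₀ →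
        r_lo / 2 < Kerr.radius a (z + w) ∧
        |Kerr.radius a (z + w) - Kerr.radius a z| ≤ L₃ * ‖w‖ ∧
        ContDiffAt ℝ 2 (Kerr.bilin M a) (z + w) ∧ ContDiffAt ℝ 2 (Kerr.radius a) (z + w) ∧
        ‖Kerr.bilin M a (z + w)‖ ≤ B₀ ∧
        ‖fderiv ℝ (Kerr.bilin M a) (z + w)‖ ≤ L₁ ∧
        ‖fderiv ℝ (Kerr.radius a) (z + w)‖ ≤ L₃ ∧
        ‖fderiv ℝ (fderiv ℝ (Kerr.radius a)) (z + w)‖ ≤ L₂ := by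
  intro M a r_lo r_hi hlo _hlohi
  -- the compact time slice of the band
  set K : Set E4 := {z : E4 | z 0 = 0 ∧ r_lo ≤ Kerr.radius a z ∧ Kerr.radius a z ≤ r_hi}
    with hKdef
  have hK : IsCompact K := kerrCylindersBendInward_isCompact_slice a r_hi hlo
  -- the open superlevel set `{r > r_lo / 2}` contains the slice, hence a closed thickening of it
  set U : Set E4 := {x : E4 | r_lo / 2 < Kerr.radius a x} with hUdef
  have hU : IsOpen U := isOpen_lt continuous_const (Kerr.continuous_radius a)
  have hKU : K ⊆ U := fun z hz ↦ (half_lt_self hlo).trans_le hz.2.1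
  obtain ⟨ρ₀, hρ₀, hρ₀U⟩ := hK.exists_cthickening_subset_open hU hKU
  -- the compact tube `T = cthickening ρ₀ K ⊆ {r > r_lo / 2} ⊆ {r > 0}`
  set T : Set E4 := Metric.cthickening ρ₀ K with hTdef
  have hT : IsCompact T := hK.cthickening
  have hTpos : ∀ x ∈ T, 0 < Kerr.radius a x := fun x hx ↦ (half_pos hlo).trans (hρ₀U hx)
  -- the four fields are continuous on the tube, hence bounded there
  have hc₀ : ContinuousOn (Kerr.bilin M a) T := fun x hx ↦
    (Kerr.contDiffAt_bilin M a (hTpos x hx) (n := 2)).continuousAt.continuousWithinAt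
  have hc₁ : ContinuousOn (fderiv ℝ (Kerr.bilin M a)) T := fun x hx ↦
    ((Kerr.contDiffAt_bilin M a (hTpos x hx) (n := 2)).fderiv_right (m := 1)
      (by norm_num)).continuousAt.continuousWithinAt
  have hc₃ : ContinuousOn (fderiv ℝ (Kerr.radius a)) T := fun x hx ↦
    ((Kerr.contDiffAt_radius (hTpos x hx) (n := 2)).fderiv_right (m := 1)
      (by norm_num)).continuousAt.continuousWithinAt
  have hc₂ : ContinuousOn (fderiv ℝ (fderiv ℝ (Kerr.radius a))) T := fun x hx ↦
    (((Kerr.contDiffAt_radius (hTpos x hx) (n := 3)).fderiv_right (m := 2)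
      (by norm_num)).fderiv_right (m := 1) (by norm_num)).continuousAt.continuousWithinAt
  obtain ⟨C₀, hC₀⟩ := hT.exists_bound_of_continuousOn hc₀
  obtain ⟨C₁, hC₁⟩ := hT.exists_bound_of_continuousOn hc₁
  obtain ⟨C₂, hC₂⟩ := hT.exists_bound_of_continuousOn hc₂
  obtain ⟨C₃, hC₃⟩ := hT.exists_bound_of_continuousOn hc₃
  refine ⟨ρ₀, max C₁ 0, max C₂ 0, max C₃ 0, max C₀ 0, hρ₀, le_max_right _ _, le_max_right _ _,
    le_max_right _ _, le_max_right _ _, ?_⟩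
  intro z hzlo hzhi
  -- translate `z` to the time slice: `z = z' + t ∂₀`, `t = z⁰`
  set t : ℝ := z 0 with ht
  set z' : E4 := z + (-t) • E4.basisVector 0 with hz'
  have hzz' : ∀ w : E4, z + w = (z' + w) + t • E4.basisVector 0 := fun w ↦ by
    rw [hz', neg_smul]; abel
  have hz'0 : z' 0 = 0 := by simp [hz', ht, E4.basisVector]
  have hrad' : Kerr.radius a z' = Kerr.radius a z :=
    Kerr.radius_add_time_smul_basisVector a z (-t)
  clear_value t z'
  have hz'K : z' ∈ K := ⟨hz'0, hrad' ▸ hzlo, hrad' ▸ hzhi⟩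
  -- the points `z' + w`, `‖w‖ ≤ ρ₀`, lie in the tube
  have hmemT : ∀ w : E4, ‖w‖ ≤ ρ₀ → z' + w ∈ T := fun w hw ↦
    Metric.mem_cthickening_of_dist_le (z' + w) z' ρ₀ K hz'K (by simpa [dist_eq_norm] using hw)
  -- stationarity of Kerr: the radius, the components and their derivatives at `z + w` are
  -- those at `z' + w`
  have hfdrad : ∀ x : E4, fderiv ℝ (Kerr.radius a) (x + t • E4.basisVector 0) =
      fderiv ℝ (Kerr.radius a) x :=
    OpensChart.fderiv_eq_of_forall_add_eq fun x ↦ Kerr.radius_add_time_smul_basisVector a x t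
  have hradT : ∀ w : E4, Kerr.radius a (z + w) = Kerr.radius a (z' + w) := fun w ↦ by
    rw [hzz' w, Kerr.radius_add_time_smul_basisVector]
  have hbilT : ∀ w : E4, Kerr.bilin M a (z + w) = Kerr.bilin M a (z' + w) := fun w ↦ by
    rw [hzz' w, Kerr.bilin_add_time M a t]
  have hfdbilT : ∀ w : E4, fderiv ℝ (Kerr.bilin M a) (z + w) =
      fderiv ℝ (Kerr.bilin M a) (z' + w) := fun w ↦ by
    rw [hzz' w]
    exact OpensChart.fderiv_eq_of_forall_add_eq (Kerr.bilin_add_time M a t) _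
  have hfdradT : ∀ w : E4, fderiv ℝ (Kerr.radius a) (z + w) =
      fderiv ℝ (Kerr.radius a) (z' + w) := fun w ↦ by
    rw [hzz' w]
    exact hfdrad _
  have hfd2radT : ∀ w : E4, fderiv ℝ (fderiv ℝ (Kerr.radius a)) (z + w) =
      fderiv ℝ (fderiv ℝ (Kerr.radius a)) (z' + w) := fun w ↦ by
    rw [hzz' w]
    exact OpensChart.fderiv_eq_of_forall_add_eq hfdrad _
  -- the two facts used along segments: lower radius bound and gradient bound in the tube
  have hstep : ∀ w : E4, ‖w‖ ≤ ρ₀ →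
      r_lo / 2 < Kerr.radius a (z + w) ∧ ‖fderiv ℝ (Kerr.radius a) (z + w)‖ ≤ max C₃ 0 := by
    intro w hw
    refine ⟨?_, ?_⟩
    · rw [hradT]
      exact hρ₀U (hmemT w hw)
    · rw [hfdradT]
      exact (hC₃ _ (hmemT w hw)).trans (le_max_left _ _)
  intro w hw
  obtain ⟨hr, hdr⟩ := hstep w hw
  have hpos : 0 < Kerr.radius a (z + w) := (half_pos hlo).trans hr
  refine ⟨hr, ?_, Kerr.contDiffAt_bilin M a hpos, Kerr.contDiffAt_radius hpos, ?_, ?_, hdr, ?_⟩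
  · -- mean value inequality on the convex closed ball `closedBall z ρ₀ ⊆` tube
    have hball : ∀ x ∈ Metric.closedBall z ρ₀, ‖x - z‖ ≤ ρ₀ := fun x hx ↦ by
      rwa [Metric.mem_closedBall, dist_eq_norm] at hx
    have hmvt := Convex.norm_image_sub_le_of_norm_fderiv_le (𝕜 := ℝ) (f := Kerr.radius a)
      (s := Metric.closedBall z ρ₀) (C := max C₃ 0) (x := z) (y := z + w)
      (fun x hx ↦ by
        have h := (hstep (x - z) (hball x hx)).1
        rw [add_sub_cancel] at h
        exact (Kerr.contDiffAt_radius ((half_pos hlo).trans h) (n := 1)).differentiableAt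
          one_ne_zero)
      (fun x hx ↦ by
        have h := (hstep (x - z) (hball x hx)).2
        rwa [add_sub_cancel] at h)
      (convex_closedBall z ρ₀) (Metric.mem_closedBall_self hρ₀.le)
      (by rwa [Metric.mem_closedBall, dist_eq_norm, add_sub_cancel_left])
    rwa [Real.norm_eq_abs, add_sub_cancel_left] at hmvt
  · rw [hbilT]
    exact (hC₀ _ (hmemT w hw)).trans (le_max_left _ _)
  · rw [hfdbilT]
    exact (hC₁ _ (hmemT w hw)).trans (le_max_left _ _)
  · rw [hfd2radT]
    exact (hC₂ _ (hmemT w hw)).trans (le_max_left _ _)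

end Summit.FinalStateConjecture.FinalStateConjecture.Theorems

end
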